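import Literature.AlgebraicGeometry.PlaneCurves.HessePencilHessian
import Literature.AlgebraicGeometry.PlaneCurves.HessePencilCharacteristicThreeNegation
import HarnessLib

/-!
# The Hessian of a member in characteristic `3` is the triangle `xyz = 0`; its flexes are the three base points (Artebani–Dolgachev, Remark 2.1)

Topic `Literature/AlgebraicGeometry/PlaneCurves`, namespace `Literature.AlgebraicGeometry.PlaneCurves`.
Lane `lit-hodgefound`, seat `lit-hodgefound-p37`, row g21-#12; built on `HessePencilHessian` (g17-#8:
`He(E_λ) = −6λ²·(X³+Y³+Z³) + (216 + 2λ³)·XYZ` over any field, and the Hessian flex criterion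
`HessianFlexCriterion.eval_det_hessianMatrix_eq_zero_iff`, Kunz Thm. 9.7, valid for `2 ≠ 0`,
`n − 1 ≠ 0`), `HessePencilCharacteristicThree` (g21-#1: for `3 = 0`, `∇E_t = t·(yz, xz, xy)`, `E_t`
nonsingular iff `t ≠ 0`, the three base points) and `HessePencilCharacteristicThreeNegation` (g21-#6:
`E_t` is a cubic form).  Everything here is PROVED; no definition, no named fact.

Source — M. Artebani, I. Dolgachev, *The Hesse pencil of plane cubic curves*, Enseign. Math. (2) 55
(2009), §2 [`paper:arxiv-math_0611590` p0004 L3]: "The Hessian curve `He(E)` of `E` is the plane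
cubic curve defined by the equation `He(F) = 0` […] The nine points in `E ∩ He(E)` are the inflection
points of `E`."; Remark 2.1 [p0005 L62], VERBATIM: "It has three base points `(1, −1, 0), (0, 1, −1),
(1, 0, −1)`, each of multiplicity 3, which are the inflection points of all nonsingular members of the
pencil."

## What is here (`3 = 0`)

* **`hesseE_det_hessianMatrix_of_three_eq_zero`**: `He(E_t) = 2t³·XYZ` — in characteristic `3` the
  Hessian curve of EVERY member is the singular member `xyz = 0` (`−6 = 216 = 0`).
* **`hesseE_flex_iff_of_three_eq_zero`** (`t ≠ 0`, `p ∈ E_t`, `p ≠ 0`): `p` is a flex (the tangent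
  meets `E_t` with multiplicity `≥ 3`, the tree's `linePoly` clause) iff `p₀p₁p₂ = 0`; the Hessian
  criterion applies since `2 ≠ 0` and `n − 1 = 2 ≠ 0` in characteristic `3`.
* **`hesseE_flex_iff_basePoint_of_three_eq_zero`**: … iff `p` is one of the three base points
  `c·(0, 1, −1)`, `c·(1, 0, −1)`, `c·(1, −1, 0)` — Remark 2.1: the base points ARE the inflection
  points of every nonsingular member.

## References
* [ArtebaniDolgachev2009] M. Artebani, I. Dolgachev, *The Hesse pencil of plane cubic curves*,
  Enseign. Math. (2) 55 (2009) 235–273, §2 (the Hessian curve), Remark 2.1.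
* [Kunz2005PlaneAlgebraicCurves] E. Kunz, *Introduction to Plane Algebraic Curves*, Birkhäuser 2005,
  Ch. 9, Thm. 9.7 (the Hessian flex criterion).
-/

set_option autoImplicit false

open MvPolynomial Matrix
open Literature.AlgebraicGeometry.HodgeTheory (hessianMatrix hessianMatrix_apply)
open Literature.AlgebraicGeometry.HyperbolicPolynomials

namespace Literature.AlgebraicGeometry.PlaneCurves

universe u

/-- The member `E_t = X³ + Y³ + Z³ + t·XYZ` (local notation, no definition). -/
local notation3 "𝐄[" t "]" =>
  (X 0 ^ 3 + X 1 ^ 3 + X 2 ^ 3 + C t * (X 0 * X 1 * X 2) : MvPolynomial (Fin 3) _)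

section CharThreeHessian

variable {K : Type u} [Field K]

/-- **In characteristic `3` the Hessian of every member is the triangle: `He(E_t) = 2t³·XYZ`**
(`He(E_λ) = −6λ²(X³+Y³+Z³) + (216 + 2λ³)XYZ` with `6 = 216 = 0`). [cite: ArtebaniDolgachev2009, §2
(the Hessian curve `He(E)`), Remark 2.1 (the singular member `xyz = 0`)] -/
theorem hesseE_det_hessianMatrix_of_three_eq_zero (h3 : (3 : K) = 0) (t : K) :
    (hessianMatrix (𝐄[t] : MvPolynomial (Fin 3) K)).det = C (2 * t ^ 3) * (X 0 * X 1 * X 2) := by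
  rw [det_hessianMatrix_hesse']
  have h6 : (-(6 * t ^ 2) : K) = 0 := by linear_combination (-(2 * t ^ 2)) * h3
  have h216 : (216 + 2 * t ^ 3 : K) = 2 * t ^ 3 := by linear_combination 72 * h3
  rw [h6, h216, map_zero, zero_mul, zero_add]

/-- `He(E_t)(p) = 2t³·p₀p₁p₂`. [cite: ArtebaniDolgachev2009, §2, Remark 2.1] -/
theorem hesseE_eval_det_hessianMatrix_of_three_eq_zero (h3 : (3 : K) = 0) (t : K) (p : Fin 3 → K) :
    eval p (hessianMatrix (𝐄[t] : MvPolynomial (Fin 3) K)).det = 2 * t ^ 3 * (p 0 * p 1 * p 2) := by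
  rw [hesseE_det_hessianMatrix_of_three_eq_zero h3]
  simp

/-- **The flexes of a nonsingular member in characteristic `3` lie on the triangle**: for `3 = 0`,
`t ≠ 0`, `p ≠ 0` on `E_t`: the tangent at `p` meets `E_t` with multiplicity `≥ 3` (for every tangent
direction `v` independent of `p`, `X³ ∣ linePoly E_t p v`) iff `p₀p₁p₂ = 0` — the Hessian criterion
(Kunz Thm. 9.7; `2 ≠ 0`, `3 − 1 ≠ 0` hold in characteristic `3`) and `He(E_t)(p) = 2t³p₀p₁p₂`.
[cite: ArtebaniDolgachev2009, §2, Remark 2.1] [cite: Kunz2005PlaneAlgebraicCurves, Ch. 9, Thm. 9.7] -/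
theorem hesseE_flex_iff_of_three_eq_zero (h3 : (3 : K) = 0) {t : K} (ht : t ≠ 0) {p : Fin 3 → K}
    (hp0 : p ≠ 0) (hp : eval p 𝐄[t] = 0) :
    (∀ v, (fun i => eval p (pderiv i 𝐄[t])) ⬝ᵥ v = 0 → LinearIndependent K ![p, v] →
        Polynomial.X ^ 3 ∣ linePoly 𝐄[t] p v) ↔ p 0 * p 1 * p 2 = 0 := by
  have h2 : (2 : K) ≠ 0 := by
    intro h2
    have : (1 : K) = 0 := by linear_combination h3 - h2
    exact one_ne_zero this
  -- `E_t` is nonsingular: `∇E_t(p) ≠ 0`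
  have hgrad : (fun i => eval p (pderiv i 𝐄[t])) ≠ 0 := fun hg =>
    ht ((hesseE_singular_iff_of_three_eq_zero h3 t).1 ⟨p, hp0, hp, hg⟩)
  have key := eval_det_hessianMatrix_eq_zero_iff (n := 3) h2 (by norm_num; exact h2)
    (hesseE_isHomogeneous t) hp0 hp
  rw [hesseE_eval_det_hessianMatrix_of_three_eq_zero h3, mul_eq_zero, mul_eq_zero,
    or_iff_right h2, or_iff_right (pow_ne_zero 3 ht)] at key
  constructor
  · intro hflex
    exact key.2 (Or.inr ⟨hgrad, hflex⟩)
  · intro hπ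
    rcases key.1 hπ with h | h
    · exact absurd h hgrad
    · exact h.2

/-- **Artebani–Dolgachev, Remark 2.1: the three base points "are the inflection points of all
nonsingular members of the pencil"** — for `3 = 0`, `t ≠ 0` and `p ≠ 0` on `E_t`: `p` is a flex iff
`p = c·(0, 1, −1)`, `c·(1, 0, −1)` or `c·(1, −1, 0)` for some `c ≠ 0`.
[cite: ArtebaniDolgachev2009, §2, Remark 2.1] -/
theorem hesseE_flex_iff_basePoint_of_three_eq_zero (h3 : (3 : K) = 0) {t : K} (ht : t ≠ 0)
    {p : Fin 3 → K} (hp0 : p ≠ 0) (hp : eval p 𝐄[t] = 0) :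
    (∀ v, (fun i => eval p (pderiv i 𝐄[t])) ⬝ᵥ v = 0 → LinearIndependent K ![p, v] →
        Polynomial.X ^ 3 ∣ linePoly 𝐄[t] p v) ↔
      ∃ c : K, c ≠ 0 ∧ (p = c • ![0, 1, -1] ∨ p = c • ![1, 0, -1] ∨ p = c • ![1, -1, 0]) := by
  rw [hesseE_flex_iff_of_three_eq_zero h3 ht hp0 hp]
  constructor
  · intro hπ
    have hS : p 0 ^ 3 + p 1 ^ 3 + p 2 ^ 3 = 0 := by
      rw [hesseE_eval, hπ, mul_zero, add_zero] at hp; exact hp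
    exact hesse_basePoint_cases_of_three_eq_zero h3 hp0 hπ hS
  · rintro ⟨c, -, h | h | h⟩ <;> rw [h] <;> simp

end CharThreeHessian

end Literature.AlgebraicGeometry.PlaneCurves
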